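import Literature.ModelTheory.ExponentialFields.ClosedTermTransfer
import HarnessLib

/-!
# Strict inequalities between rational exponential constants transfer from `ℝ` to ordered exponential fields

Family `periods` (periods.S27), topic `Literature/ModelTheory/ExponentialFields`: companion of
`ClosedTermTransfer.lean` (leaf (B6) of the decomposition of the conditional half of
Macintyre–Wilkie's theorem).  There, strict inequalities between *closed terms* of
`Language.orderedExpRing` (integer exponential constants) were transferred from `ℝ` to every
ordered field with an `IsOrderedExp` map.  Macintyre–Wilkie's Newton step is run at a **rational**
approximation `q̄ ∈ ℚⁿ` of a real zero (Jones–Servi 2011, Lemma 3.6: "Let `h ∈ M_n(ℤ[α])`,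
`q̄ ∈ ℚⁿ` and suppose that `ℝ^α ⊨ h(q̄) < 0`. Then `T ⊢ h(q̄) < 0`"), and rationals are not closed
terms of the language (no division).  This file therefore redoes the enclosure argument for the
values `h(q̄)`: *rational exponential expressions* (`RatExpExpr`: rational constants, `+`, `*`,
`-`, `exp`), evaluated in any field `K` with a map `E` through `Rat.cast` (`RatExpExpr.eval`), in
particular the values at rational points of exponential terms (`RatExpExpr.ofTerm`,
`eval_ofTerm`):

* `RatExpExpr.exists_uniformlyNear` (proved): uniform rational enclosures, simultaneously in all
  ordered fields (in `Type`) with an `IsOrderedExp` map (the induction of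
  `exists_uniformlyNear` of `ClosedTermTransfer.lean`, whose `exp` step already enclosed `E` at
  rational arguments: `lowerEncl_le`, `le_upperEncl`);
* `RatExpExpr.eval_lt_eval_of_real` (proved): **if `e₁ < e₂` holds in `ℝ` (with `Real.exp`) then
  `e₁ < e₂` holds in every such `K`** — Jones–Servi's Lemma 3.6 for `exp`, now at rational points;
* `RatExpExpr.realize_eq_eval_ofTerm` (proved): in a lawful structure whose `exp` symbol is `E`,
  the value of a term `t(x̄)` at a rational point `q̄` is the value of the rational exponential
  expression `ofTerm q̄ t`.

Everything here is proved; no new named facts.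

## References

* G. O. Jones, T. Servi, *On the decidability of the real field with a generic power function*,
  J. Symb. Log. 76 (2011), Lemma 3.6.
* A. Macintyre, A. J. Wilkie, *On the decidability of the real exponential field* (1996), §4.
-/

noncomputable section

open FirstOrder FirstOrder.Language Filter
open scoped Topology

namespace Literature.ModelTheory.ExponentialFields

/-- **Rational exponential expressions**: the closure of the rational constants under `+`, `*`,
`-` and a unary `exp` — the shape of the values `h(q̄)`, `q̄ ∈ ℚⁿ`, of exponential polynomials /
terms at rational points (Jones–Servi 2011, Lemma 3.6). A definition (syntax). [folklore] -/
inductive RatExpExpr : Type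
  | const : ℚ → RatExpExpr
  | add : RatExpExpr → RatExpExpr → RatExpExpr
  | mul : RatExpExpr → RatExpExpr → RatExpExpr
  | neg : RatExpExpr → RatExpExpr
  | exp : RatExpExpr → RatExpExpr
  deriving DecidableEq

namespace RatExpExpr

variable {K : Type*} [Field K]

/-- Evaluation of a rational exponential expression in a field `K` with a map `E : K → K`
(rationals through `Rat.cast`). [folklore] -/
def eval (E : K → K) : RatExpExpr → K
  | const q => (q : K)
  | add e₁ e₂ => eval E e₁ + eval E e₂
  | mul e₁ e₂ => eval E e₁ * eval E e₂
  | neg e => -eval E e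
  | exp e => E (eval E e)

/-- `eval` on a constant. [folklore] -/
@[simp] theorem eval_const (E : K → K) (q : ℚ) : eval E (const q) = (q : K) := rfl
/-- `eval` on a sum. [folklore] -/
@[simp] theorem eval_add (E : K → K) (e₁ e₂ : RatExpExpr) : eval E (add e₁ e₂) = eval E e₁ + eval E e₂ := rfl
/-- `eval` on a product. [folklore] -/
@[simp] theorem eval_mul (E : K → K) (e₁ e₂ : RatExpExpr) : eval E (mul e₁ e₂) = eval E e₁ * eval E e₂ := rfl
/-- `eval` on a negation. [folklore] -/
@[simp] theorem eval_neg (E : K → K) (e : RatExpExpr) : eval E (neg e) = -eval E e := rfl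
/-- `eval` on an exponential. [folklore] -/
@[simp] theorem eval_exp (E : K → K) (e : RatExpExpr) : eval E (exp e) = E (eval E e) := rfl

/-! ### Terms at rational points -/

/-- The rational exponential expression of a term of `Language.orderedExpRing` (in variables
`α`, no parameters beyond them) at a rational point `q : α → ℚ`. [folklore] -/
def ofTerm {α : Type*} (q : α → ℚ) : Language.orderedExpRing.Term α → RatExpExpr
  | var a => const (q a)
  | func expRingFunc.add ts => add ((fun i => ofTerm q (ts i)) 0) ((fun i => ofTerm q (ts i)) 1)
  | func expRingFunc.mul ts => mul ((fun i => ofTerm q (ts i)) 0) ((fun i => ofTerm q (ts i)) 1)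
  | func expRingFunc.neg ts => neg ((fun i => ofTerm q (ts i)) 0)
  | func expRingFunc.zero _ => const 0
  | func expRingFunc.one _ => const 1
  | func expRingFunc.exp ts => exp ((fun i => ofTerm q (ts i)) 0)

/-- **Values of terms at rational points are values of rational exponential expressions**: in a
lawful `Language.orderedExpRing`-structure on a field `K` whose `exp` symbol is interpreted by
`E`, `t(q̄) = eval E (ofTerm q̄ t)`. [folklore] -/
theorem realize_eq_eval_ofTerm [LinearOrder K] [Language.orderedExpRing.Structure K]
    [RealExpModel.LawfulStructure K] {E : K → K}
    (hexp : ∀ v : Fin 1 → K, Structure.funMap (L := Language.orderedExpRing) expRingFunc.exp v = E (v 0))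
    {α : Type*} (q : α → ℚ) :
    ∀ t : Language.orderedExpRing.Term α,
      t.realize (fun a => ((q a : ℚ) : K)) = eval E (ofTerm q t)
  | var a => by simp [ofTerm]
  | func expRingFunc.add ts => by
    rw [Term.realize_func, RealExpModel.LawfulStructure.funMap_add]
    simp only [ofTerm, eval_add, realize_eq_eval_ofTerm hexp q (ts 0), realize_eq_eval_ofTerm hexp q (ts 1)]
  | func expRingFunc.mul ts => by
    rw [Term.realize_func, RealExpModel.LawfulStructure.funMap_mul]
    simp only [ofTerm, eval_mul, realize_eq_eval_ofTerm hexp q (ts 0), realize_eq_eval_ofTerm hexp q (ts 1)]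
  | func expRingFunc.neg ts => by
    rw [Term.realize_func, RealExpModel.LawfulStructure.funMap_neg]
    simp only [ofTerm, eval_neg, realize_eq_eval_ofTerm hexp q (ts 0)]
  | func expRingFunc.zero ts => by
    rw [Term.realize_func, RealExpModel.LawfulStructure.funMap_zero]
    simp [ofTerm]
  | func expRingFunc.one ts => by
    rw [Term.realize_func, RealExpModel.LawfulStructure.funMap_one]
    simp [ofTerm]
  | func expRingFunc.exp ts => by
    rw [Term.realize_func, hexp]
    simp only [ofTerm, eval_exp, realize_eq_eval_ofTerm hexp q (ts 0)]

/-! ### Uniform rational enclosures -/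

/-- `UniformlyNear e c r`: in **every** ordered field `K` (in `Type`) with an `IsOrderedExp` map
`E`, `|eval E e − c| < r`. [folklore] -/
def UniformlyNear (e : RatExpExpr) (c r : ℚ) : Prop :=
  ∀ (K : Type) [Field K] [LinearOrder K] [IsStrictOrderedRing K] (E : K → K), IsOrderedExp E →
    |eval E e - (c : K)| < (r : K)

/-- `ℝ` with `Real.exp` is one of the structures quantified over. [folklore] -/
theorem UniformlyNear.real {e : RatExpExpr} {c r : ℚ} (h : UniformlyNear e c r) :
    |eval Real.exp e - (c : ℝ)| < (r : ℝ) :=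
  h ℝ Real.exp IsOrderedExp.real

/-- **Uniform rational enclosures of rational exponential expressions** (the induction of
`exists_uniformlyNear`, `ClosedTermTransfer.lean`, with rational constants as base case). [cite: JonesServi2011, Lemma 3.6 (proof)] -/
theorem exists_uniformlyNear (e : RatExpExpr) {r : ℚ} (hr : 0 < r) : ∃ c : ℚ, UniformlyNear e c r := by
  induction e generalizing r with
  | const q =>
    exact ⟨q, fun K _ _ _ E hE => by simpa using hr⟩
  | neg e ih =>
    obtain ⟨c, hc⟩ := ih hr
    refine ⟨-c, fun K _ _ _ E hE => ?_⟩
    have := hc K E hE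
    rw [← abs_neg] at this
    push_cast
    simp only [eval_neg]
    convert this using 2
    ring
  | add e₁ e₂ ih₁ ih₂ =>
    obtain ⟨c₀, hc₀⟩ := ih₁ (half_pos hr)
    obtain ⟨c₁, hc₁⟩ := ih₂ (half_pos hr)
    refine ⟨c₀ + c₁, fun K _ _ _ E hE => ?_⟩
    have h₀ := hc₀ K E hE
    have h₁ := hc₁ K E hE
    push_cast at h₀ h₁ ⊢
    simp only [eval_add]
    calc |eval E e₁ + eval E e₂ - (c₀ + c₁)|
        = |(eval E e₁ - c₀) + (eval E e₂ - c₁)| := by ring_nf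
      _ ≤ |eval E e₁ - c₀| + |eval E e₂ - c₁| := abs_add_le _ _
      _ < r / 2 + r / 2 := add_lt_add h₀ h₁
      _ = r := by ring
  | mul e₁ e₂ ih₁ ih₂ =>
    obtain ⟨d₀, hd₀⟩ := ih₁ one_pos
    set B₀ : ℚ := |d₀| + 1 with hB₀
    have hB₀pos : 0 < B₀ := by positivity
    obtain ⟨c₁, hc₁⟩ := ih₂ (div_pos hr (mul_pos two_pos hB₀pos))
    have hC : 0 < |c₁| + 1 := by positivity
    obtain ⟨c₀, hc₀⟩ := ih₁ (div_pos hr (mul_pos two_pos hC))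
    refine ⟨c₀ * c₁, fun K _ _ _ E hE => ?_⟩
    have hs₀ := hd₀ K E hE
    have hs := hc₀ K E hE
    have ht := hc₁ K E hE
    push_cast at hs₀ hs ht ⊢
    simp only [eval_mul]
    set s : K := eval E e₁
    set t : K := eval E e₂
    have hsB : |s| < (B₀ : K) := by
      have : |s| ≤ |s - d₀| + |(d₀ : K)| := by
        simpa using abs_add_le (s - d₀) (d₀ : K)
      push_cast [hB₀]
      linarith
    have hCK : (0 : K) < |(c₁ : K)| + 1 := by positivity
    calc |s * t - c₀ * c₁| = |s * (t - c₁) + c₁ * (s - c₀)| := by ring_nf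
      _ ≤ |s * (t - c₁)| + |c₁ * (s - c₀)| := abs_add_le _ _
      _ = |s| * |t - c₁| + |(c₁ : K)| * |s - c₀| := by rw [abs_mul, abs_mul]
      _ < (B₀ : K) * ((r : K) / (2 * (B₀ : K))) +
            (|(c₁ : K)| + 1) * ((r : K) / (2 * (|(c₁ : K)| + 1))) := by
          apply add_lt_add
          · exact mul_lt_mul'' hsB ht (abs_nonneg _) (abs_nonneg _)
          · exact mul_lt_mul' (by linarith) hs (abs_nonneg _) hCK
      _ = r := by
          have hB₀K : (0 : K) < B₀ := by exact_mod_cast hB₀pos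
          field_simp
          ring
  | exp e ih =>
    obtain ⟨d, hd⟩ := ih one_pos
    set B : ℚ := d + 3 with hB
    obtain ⟨m₀, hm₀pos, hm₀⟩ : ∃ m₀ : ℕ, 0 < m₀ ∧ B < m₀ := by
      obtain ⟨n, hn⟩ := exists_nat_gt B
      exact ⟨n + 1, Nat.succ_pos n, hn.trans (by exact_mod_cast Nat.lt_succ_self n)⟩
    set U : ℚ := upperEncl B m₀ with hU
    have hUexp : Real.exp B ≤ (U : ℝ) := le_upperEncl IsOrderedExp.real B hm₀pos hm₀
    have hUpos : 0 < U := by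
      have : (0 : ℝ) < U := lt_of_lt_of_le (Real.exp_pos _) hUexp
      exact_mod_cast this
    set δ : ℚ := min 1 (r / (4 * U)) with hδ
    have hδpos : 0 < δ := lt_min one_pos (by positivity)
    have hδ1 : δ ≤ 1 := min_le_left _ _
    have hδU : δ * U ≤ r / 4 := by
      have : δ ≤ r / (4 * U) := min_le_right _ _
      calc δ * U ≤ r / (4 * U) * U := by gcongr
        _ = r / 4 := by field_simp
    obtain ⟨c, hc⟩ := ih hδpos
    have hcd : |c - d| < 1 + δ := by
      have h1 : |(eval Real.exp e : ℝ) - (d : ℝ)| < ((1 : ℚ) : ℝ) := hd.real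
      have h2 : |(eval Real.exp e : ℝ) - (c : ℝ)| < ((δ : ℚ) : ℝ) := hc.real
      have h3 : |(c : ℝ) - d| < 1 + δ := by
        have key : |(c : ℝ) - d| ≤ |(eval Real.exp e : ℝ) - (d : ℝ)| +
            |(eval Real.exp e : ℝ) - (c : ℝ)| := by
          calc |(c : ℝ) - d| = |((eval Real.exp e : ℝ) - d) - ((eval Real.exp e : ℝ) - c)| := by
                ring_nf
            _ ≤ _ := abs_sub _ _
        push_cast at h1 h2
        linarith
      exact_mod_cast h3
    have hcδB : c + δ ≤ B := by
      rw [hB]; have := (abs_lt.1 hcd).2; linarith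
    have hev₁ : ∀ᶠ m : ℕ in atTop, (upperEncl (c + δ) m : ℝ) < Real.exp (c + δ : ℚ) + r / 4 :=
      (tendsto_upperEncl (c + δ)).eventually_lt_const (by
        have : (0 : ℝ) < r := by exact_mod_cast hr
        linarith)
    have hev₂ : ∀ᶠ m : ℕ in atTop, Real.exp (c - δ : ℚ) - r / 4 < (lowerEncl (c - δ) m : ℝ) :=
      (tendsto_lowerEncl (c - δ)).eventually_const_lt (by
        have : (0 : ℝ) < r := by exact_mod_cast hr
        linarith)
    have hev₃ : ∀ᶠ m : ℕ in atTop, (|c| + 1 : ℚ) < m := by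
      obtain ⟨n, hn⟩ := exists_nat_gt (|c| + 1 : ℚ)
      refine eventually_atTop.2 ⟨n, fun m hm => hn.trans_le (by exact_mod_cast hm)⟩
    have hev₄ : ∀ᶠ m : ℕ in atTop, 0 < m := eventually_gt_atTop 0
    obtain ⟨m, ⟨⟨hm₁, hm₂⟩, hm₃⟩, hm₄⟩ := (((hev₁.and hev₂).and hev₃).and hev₄).exists
    set L : ℚ := lowerEncl (c - δ) m with hL
    set U' : ℚ := upperEncl (c + δ) m with hU'
    have hcm₁ : -(c - δ) ≤ m := by
      have := neg_le_abs c; linarith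
    have hcm₂ : c + δ < m := by
      have := le_abs_self c; linarith
    have hwidth : U' - L < r := by
      have hmono : Real.exp (c + δ : ℚ) - Real.exp (c - δ : ℚ) ≤ r / 2 := by
        have hxy : Real.exp (c - δ : ℚ) ≥ Real.exp (c + δ : ℚ) * (1 + ((c - δ : ℚ) - (c + δ : ℚ) : ℝ)) := by
          have := Real.add_one_le_exp (((c - δ : ℚ) : ℝ) - ((c + δ : ℚ) : ℝ))
          have hpos := Real.exp_pos ((c + δ : ℚ) : ℝ)
          calc Real.exp (c + δ : ℚ) * (1 + ((c - δ : ℚ) - (c + δ : ℚ) : ℝ))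
              ≤ Real.exp (c + δ : ℚ) * Real.exp (((c - δ : ℚ) : ℝ) - ((c + δ : ℚ) : ℝ)) := by
                gcongr; linarith
            _ = Real.exp (c - δ : ℚ) := by rw [← Real.exp_add]; ring_nf
        have hle : Real.exp (c + δ : ℚ) ≤ U := by
          refine le_trans (Real.exp_le_exp.2 ?_) hUexp
          exact_mod_cast hcδB
        have hδUR : (δ : ℝ) * U ≤ r / 4 := by exact_mod_cast hδU
        have hδR : (0 : ℝ) ≤ δ := by exact_mod_cast hδpos.le
        push_cast at hxy hle ⊢
        have h1 : Real.exp ((c : ℝ) + δ) * (1 + ((c : ℝ) - δ - ((c : ℝ) + δ))) =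
            Real.exp ((c : ℝ) + δ) - 2 * ((δ : ℝ) * Real.exp ((c : ℝ) + δ)) := by ring
        rw [h1] at hxy
        have h2 : (δ : ℝ) * Real.exp ((c : ℝ) + δ) ≤ (δ : ℝ) * U :=
          mul_le_mul_of_nonneg_left hle hδR
        linarith
      have : (U' : ℝ) - L < r := by
        push_cast [hL, hU'] at hm₁ hm₂ hmono ⊢
        linarith
      exact_mod_cast this
    refine ⟨(L + U') / 2, fun K _ _ _ E' hE => ?_⟩
    have hs := hc K E' hE
    simp only [eval_exp]
    set s : K := eval E' e
    have hs' := abs_lt.1 hs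
    have hlo : E' ((c - δ : ℚ) : K) < E' s := hE.strictMono (by push_cast; linarith)
    have hhi : E' s < E' ((c + δ : ℚ) : K) := hE.strictMono (by push_cast; linarith)
    have hLK : ((L : ℚ) : K) ≤ E' ((c - δ : ℚ) : K) := lowerEncl_le hE (c - δ) hm₄ hcm₁
    have hUK : E' ((c + δ : ℚ) : K) ≤ ((U' : ℚ) : K) := le_upperEncl hE (c + δ) hm₄ hcm₂
    have hw : ((U' : ℚ) : K) - L < r := by
      have := Rat.cast_lt (K := K) |>.2 hwidth
      push_cast at this ⊢
      exact this
    rw [abs_lt]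
    push_cast
    constructor <;> linarith

/-! ### Transfer of strict inequalities -/

/-- **Strict inequalities between rational exponential constants transfer from `ℝ`** (Jones–Servi
2011, Lemma 3.6, for `exp` and the weakest theory): if `eval exp e₁ < eval exp e₂` in `ℝ` then
`eval E e₁ < eval E e₂` in every ordered field `K` (in `Type`) with an `IsOrderedExp` map `E`. [cite: JonesServi2011, Lemma 3.6] -/
theorem eval_lt_eval_of_real {e₁ e₂ : RatExpExpr}
    (h : eval Real.exp e₁ < eval Real.exp e₂)
    (K : Type) [Field K] [LinearOrder K] [IsStrictOrderedRing K] (E : K → K)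
    (hE : IsOrderedExp E) : eval E e₁ < eval E e₂ := by
  obtain ⟨r, hr₀, hr⟩ := exists_rat_btwn (show (0 : ℝ) < (eval Real.exp e₂ - eval Real.exp e₁) / 4 by
    linarith)
  have hrpos : 0 < r := by exact_mod_cast hr₀
  obtain ⟨cs, hcs⟩ := exists_uniformlyNear e₁ hrpos
  obtain ⟨ct, hct⟩ := exists_uniformlyNear e₂ hrpos
  have h₁ := abs_lt.1 hcs.real
  have h₂ := abs_lt.1 hct.real
  have hsep : cs + r ≤ ct - r := by
    have : (cs : ℝ) + r ≤ ct - r := by linarith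
    exact_mod_cast this
  have hsK := abs_lt.1 (hcs K E hE)
  have htK := abs_lt.1 (hct K E hE)
  have hsepK : (cs : K) + r ≤ (ct : K) - r := by
    have := Rat.cast_le (K := K) |>.2 hsep
    push_cast at this
    exact this
  linarith

/-- **Values of terms at rational points**: if `s(q̄) < t(q̄)` holds in `ℝ` for terms `s, t` and a
rational point `q̄`, then it holds in every ordered field `K` with a lawful structure whose `exp`
symbol is an `IsOrderedExp` map, at the point `q̄` cast into `K`. [cite: JonesServi2011, Lemma 3.6] -/
theorem realize_lt_realize_at_rat_of_real {α : Type*} (q : α → ℚ)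
    {s t : Language.orderedExpRing.Term α}
    (h : s.realize (fun a => ((q a : ℚ) : ℝ)) < t.realize (fun a => ((q a : ℚ) : ℝ)))
    (K : Type) [Field K] [LinearOrder K] [IsStrictOrderedRing K]
    [Language.orderedExpRing.Structure K] [RealExpModel.LawfulStructure K] (E : K → K)
    (hE : IsOrderedExp E)
    (hexp : ∀ v : Fin 1 → K, Structure.funMap (L := Language.orderedExpRing) expRingFunc.exp v = E (v 0)) :
    s.realize (fun a => ((q a : ℚ) : K)) < t.realize (fun a => ((q a : ℚ) : K)) := by
  rw [realize_eq_eval_ofTerm hexp q s, realize_eq_eval_ofTerm hexp q t]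
  rw [realize_eq_eval_ofTerm (K := ℝ) (E := Real.exp) (fun _ => rfl) q s,
    realize_eq_eval_ofTerm (K := ℝ) (E := Real.exp) (fun _ => rfl) q t] at h
  exact eval_lt_eval_of_real h K E hE

end RatExpExpr

end Literature.ModelTheory.ExponentialFields

end
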